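import Summits.Parity.GeneralizedHardyLittlewood.Theorems.LeeYangFibresCellParityLawDefs
import Summits.Parity.GeneralizedHardyLittlewood.Theorems.LeeYangFibresCellParityLawSingularRatio
import Summits.Parity.GeneralizedHardyLittlewood.Theorems.LeeYangFibresCellParityLawEulerRatio
import Summits.Parity.GeneralizedHardyLittlewood.Theorems.LeeYangFibresCellParityLawSieveDefs
import Literature.NumberTheory.Sieve.SieveFunctions
import Literature.NumberTheory.Sieve.SieveFramework
import Literature.NumberTheory.Sieve.JurkatRichertRefutation
import Literature.NumberTheory.Sieve.LinearEquationsInPrimesLocalObstruction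
import Literature.NumberTheory.Sieve.DiamondHalberstamTwoLinearSetup
import HarnessLib

/-!
# Route `LeeYangFibres`, crux `CellParityLaw` (stmt-Parity-14109), line `section-annihilator`:
# the registered stub `stub_sectionDimension` — dimension `Ω(1, L')` of the section densities

We prove `SectionDimension` (vocabulary file `LeeYangFibresCellParityLawSieveDefs`, skeleton v9): for
every number `t` of frozen forms there is ONE constant `L' = L'(t)` such that, for every one-dimensional
system `Ψ = (ψ₀, …, ψ_t)` of `t + 1` affine-linear forms `ψ_k(n) = a_k n + b_k` and every coordinate `i`
whose section density `g = g_{Ψ,i}` has no degenerate prime (`g(p) < 1` for all primes `p`), the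
arithmetic function `sectionDensityFn Ψ i` satisfies Iwaniec's regular dimension condition
`Ω(1, L')` (`HasIwaniecDimension`): `0 ≤ g(p) < 1` and
`∏_{w ≤ p < z} (1 - g(p))⁻¹ ≤ (log z / log w) (1 + L'/log w)` for `2 ≤ w ≤ z`. We take
`L' = C_t e^{C_t/log 2}`, `C_t = 50 + 2(2t+1)²`.

Proof. At a prime `p` write `G = goodCount Ψ p ≤ G' = goodCount Ψ₋ᵢ p` (residues mod `p` killed by
no form); the Euler-ratio file gives `g(p) = (G' - G)/G'` (`EulerRatioAux.sectionDensity_prime`; Lean's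
`x/0 = 0`). A one-dimensional form `a v + b` has at most one zero mod `p` unless it vanishes identically
mod `p`, in which case no residue is good. Hence, if `G' > 0`: `g(p) < 1` forces `G ≥ 1`, so `ψ_i` is not
identically `0` mod `p`, deleting it loses at most one residue (`goodCount_removeNth_le_add`),
`G' ≤ G + 1`, and `g(p) ≤ 1/2`; moreover no frozen form is identically `0` mod `p`, so `G' ≥ p - t` and
`g(p) ≤ 1/(p - t)` for `p > t`. (If `G' = 0` then `g(p) = 0`.) Consequently, for every prime `p`,
`(1 - g(p))⁻¹ ≤ (1 - 1/p)⁻¹ · e^{(2t+1)²/p²}`: for `p ≤ 2t + 1` because `(1 - g)⁻¹ ≤ 2 ≤ 1 + (2t+1)²/p²`,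
and for `p ≥ 2t + 2` because `(1 - 1/(p-t))⁻¹ (1 - 1/p) = 1 + t/(p(p-t-1)) ≤ 1 + 2t/p²`. Multiplying over
the window, `∏_{w ≤ p < z} (1 - 1/p)⁻¹ = Π(z)/Π(w) ≤ (log z/log w) e^{50/log w}` by Mertens' product
theorem with rate (`PairProducts.abs_log_mertensProd_sub_le`), and `∑_{w ≤ p < z} 1/p² ≤ 2/w ≤ 2/log w`
(`sum_window_inv_sq_le`); finally `e^{C/log w} ≤ 1 + (C e^{C/log 2})/log w`. (Template:
`hasIwaniecDimension_shiftedPrimesDensity_two` in `ChenTwinSieveLowerHolds.lean`.)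

References: H. Iwaniec, *Rosser's sieve*, Acta Arith. 36 (1980), (1.2) (the condition `Ω(κ, L)`)
[IwaniecActaArith1980]; G. H. Hardy, E. M. Wright, Thm 429 (Mertens) [HardyWright2008]; B. Green,
T. Tao, Ann. of Math. 171 (2010), proof of Lemma 1.3 (local counts) [GreenTao2010].
-/

noncomputable section

open scoped BigOperators Classical
open Finset Literature.NumberTheory.Sieve

namespace Summit.Parity.GeneralizedHardyLittlewood.Cruxes.CellParityLaw.SectionAnnihilator

namespace DimensionAux

variable {t : ℕ}

/-! ## Zeros of one-dimensional forms mod `p` and good counts -/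

/-- A one-dimensional form `a v + b` has at most one zero mod `p`, unless it vanishes identically
mod `p` (`p ∣ a` and `p ∣ b`). -/
theorem card_zeros_le_one_or_forall (ψ : AffLinForm 1) (p : ℕ) [Fact p.Prime] :
    #{v : Fin 1 → ZMod p | ψ.modEval p v = 0} ≤ 1 ∨ ∀ v : Fin 1 → ZMod p, ψ.modEval p v = 0 := by
  by_cases ha : ((ψ.coeff 0 : ℤ) : ZMod p) = 0
  · by_cases hb : ((ψ.const : ℤ) : ZMod p) = 0
    · exact Or.inr fun v => by rw [SingularRatio.modEval_one, ha, hb, zero_mul, zero_add]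
    · left
      have h0 : ({v : Fin 1 → ZMod p | ψ.modEval p v = 0} : Finset _) = ∅ := by
        rw [Finset.filter_eq_empty_iff]
        intro v _ hv
        rw [SingularRatio.modEval_one, ha, zero_mul, zero_add] at hv
        exact hb hv
      rw [h0, Finset.card_empty]
      exact Nat.zero_le 1
  · exact Or.inl (card_zeros_eq_one_of_coeff ψ ha).le

/-- A form vanishing identically mod `p` leaves no good residue: `goodCount Φ p = 0`. -/
theorem goodCount_eq_zero_of_forall {s : ℕ} (Φ : Fin s → AffLinForm 1) (p : ℕ) [NeZero p]
    (k : Fin s) (hk : ∀ v : Fin 1 → ZMod p, (Φ k).modEval p v = 0) : goodCount Φ p = 0 := by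
  unfold goodCount
  rw [Finset.card_eq_zero, Finset.filter_eq_empty_iff]
  intro v _ hv
  exact hv k (hk v)

/-- If some residue is good for the system, every form has at most one zero mod `p`. -/
theorem card_zeros_le_one_of_goodCount_pos {s : ℕ} (Φ : Fin s → AffLinForm 1) (p : ℕ)
    [Fact p.Prime] (hG : 0 < goodCount Φ p) (k : Fin s) :
    #{v : Fin 1 → ZMod p | (Φ k).modEval p v = 0} ≤ 1 :=
  (card_zeros_le_one_or_forall (Φ k) p).elim id fun h =>
    absurd (goodCount_eq_zero_of_forall Φ p k h) hG.ne'

/-- If some residue is good for `s` one-dimensional forms, then at least `p - s` residues are: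
`p ≤ goodCount Φ p + s` (each form kills at most one residue; cf. `le_goodCount_add`). -/
theorem le_goodCount_add_of_pos {s : ℕ} (Φ : Fin s → AffLinForm 1) (p : ℕ) [Fact p.Prime]
    (hG : 0 < goodCount Φ p) : p ≤ goodCount Φ p + s := by
  -- adapted from `le_goodCount_add` (LinearEquationsInPrimesLocalObstruction.lean)
  have hbad : #(Finset.univ.filter fun v : Fin 1 → ZMod p => ¬ ∀ k, ¬ (Φ k).modEval p v = 0) ≤ s := by
    have h1 : (Finset.univ.filter fun v : Fin 1 → ZMod p => ¬ ∀ k, ¬ (Φ k).modEval p v = 0) =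
        Finset.univ.biUnion fun k => Finset.univ.filter fun v : Fin 1 → ZMod p =>
          (Φ k).modEval p v = 0 := by
      ext v
      simp
    rw [h1]
    refine Finset.card_biUnion_le.trans ?_
    calc ∑ k, #{v : Fin 1 → ZMod p | (Φ k).modEval p v = 0} ≤ ∑ _k : Fin s, 1 :=
          Finset.sum_le_sum fun k _ => card_zeros_le_one_of_goodCount_pos Φ p hG k
      _ = s := by simp
  have htot := Finset.card_filter_add_card_filter_not (s := (Finset.univ : Finset (Fin 1 → ZMod p)))
    (fun v => ∀ k, ¬ (Φ k).modEval p v = 0)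
  rw [Finset.card_univ, card_zmod_pow, pow_one] at htot
  unfold goodCount at hG ⊢
  omega

/-- **The local counts under `g(p) < 1`.** With `G = goodCount Ψ p`, `G' = goodCount Ψ₋ᵢ p > 0`:
`g(p) = (G' - G)/G' < 1` forces `G ≥ 1`; hence `ψ_i` is not identically `0` mod `p`, deleting it loses
at most one residue, `G' ≤ G + 1`; and no frozen form is identically `0` mod `p`, so `p ≤ G' + t`. -/
theorem goodCount_facts (Ψ : Fin (t + 1) → AffLinForm 1) (i : Fin (t + 1)) (p : ℕ) [Fact p.Prime]
    (h : sectionDensity Ψ i p < 1) (hG' : 0 < goodCount (Fin.removeNth i Ψ) p) :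
    0 < goodCount Ψ p ∧ goodCount (Fin.removeNth i Ψ) p ≤ goodCount Ψ p + 1 ∧
      p ≤ goodCount (Fin.removeNth i Ψ) p + t := by
  have hG : 0 < goodCount Ψ p := by
    by_contra h0
    have h0' : goodCount Ψ p = 0 := by omega
    rw [EulerRatioAux.sectionDensity_prime Ψ i, h0', Nat.cast_zero, sub_zero,
      div_self (Nat.cast_ne_zero.mpr hG'.ne')] at h
    exact lt_irrefl _ h
  refine ⟨hG, ?_, le_goodCount_add_of_pos _ p hG'⟩
  calc goodCount (Fin.removeNth i Ψ) p
      ≤ goodCount Ψ p + #{v : Fin 1 → ZMod p | (Ψ i).modEval p v = 0} :=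
        goodCount_removeNth_le_add Ψ i p
    _ ≤ goodCount Ψ p + 1 :=
        Nat.add_le_add_left (card_zeros_le_one_of_goodCount_pos Ψ p hG i) _

/-! ## The section density at a prime: `0 ≤ g(p) ≤ 1/2` and `g(p) ≤ 1/(p - t)` -/

/-- `0 ≤ g(p)` at every prime (`G ≤ G'`; real division). -/
theorem sectionDensity_prime_nonneg (Ψ : Fin (t + 1) → AffLinForm 1) (i : Fin (t + 1)) (p : ℕ)
    [Fact p.Prime] : 0 ≤ sectionDensity Ψ i p := by
  rw [EulerRatioAux.sectionDensity_prime Ψ i]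
  exact div_nonneg (sub_nonneg.mpr (by exact_mod_cast SingularRatio.goodCount_le_removeNth Ψ i p))
    (Nat.cast_nonneg _)

/-- Under `g(p) < 1`: `g(p) ≤ 1/2` (`G' ≤ G + 1 ≤ 2G`, or `G' = 0` and `g(p) = 0`). -/
theorem sectionDensity_prime_le_half (Ψ : Fin (t + 1) → AffLinForm 1) (i : Fin (t + 1)) (p : ℕ)
    [Fact p.Prime] (h : sectionDensity Ψ i p < 1) : sectionDensity Ψ i p ≤ 1 / 2 := by
  rcases Nat.eq_zero_or_pos (goodCount (Fin.removeNth i Ψ) p) with h0 | hpos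
  · rw [EulerRatioAux.sectionDensity_prime Ψ i, h0, Nat.cast_zero, div_zero]
    norm_num
  · obtain ⟨hG, hG', -⟩ := goodCount_facts Ψ i p h hpos
    have hG1 : (1 : ℝ) ≤ goodCount Ψ p := by exact_mod_cast hG
    have hG'1 : (goodCount (Fin.removeNth i Ψ) p : ℝ) ≤ goodCount Ψ p + 1 := by exact_mod_cast hG'
    have hpos' : (0 : ℝ) < goodCount (Fin.removeNth i Ψ) p := by exact_mod_cast hpos
    rw [EulerRatioAux.sectionDensity_prime Ψ i, div_le_iff₀ hpos']
    linarith

/-- Under `g(p) < 1` and `p > t`: `g(p) ≤ 1/(p - t)` (`G' - G ≤ 1` and `G' ≥ p - t`, or `G' = 0`). -/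
theorem sectionDensity_prime_le_inv (Ψ : Fin (t + 1) → AffLinForm 1) (i : Fin (t + 1)) (p : ℕ)
    [Fact p.Prime] (h : sectionDensity Ψ i p < 1) (htp : t < p) :
    sectionDensity Ψ i p ≤ 1 / ((p : ℝ) - t) := by
  have hpt : (0 : ℝ) < (p : ℝ) - t := by
    have : (t : ℝ) < p := by exact_mod_cast htp
    linarith
  rcases Nat.eq_zero_or_pos (goodCount (Fin.removeNth i Ψ) p) with h0 | hpos
  · rw [EulerRatioAux.sectionDensity_prime Ψ i, h0, Nat.cast_zero, div_zero]
    positivity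
  · obtain ⟨-, hG', hp⟩ := goodCount_facts Ψ i p h hpos
    have hG'1 : (goodCount (Fin.removeNth i Ψ) p : ℝ) ≤ goodCount Ψ p + 1 := by exact_mod_cast hG'
    have hp' : (p : ℝ) ≤ goodCount (Fin.removeNth i Ψ) p + t := by exact_mod_cast hp
    have hpos' : (0 : ℝ) < goodCount (Fin.removeNth i Ψ) p := by exact_mod_cast hpos
    rw [EulerRatioAux.sectionDensity_prime Ψ i, div_le_div_iff₀ hpos' hpt, one_mul]
    nlinarith [mul_nonneg (sub_nonneg.mpr hG'1) hpt.le]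

/-! ## The majorant's Euler factors and their window products -/

/-- **Termwise comparison with the Mertens factor.** For a prime `p` and a real `g ≤ 1/2` with
`g ≤ 1/(p - t)` when `p > t`: `(1 - g)⁻¹ ≤ (1 - 1/p)⁻¹ e^{(2t+1)²/p²}`
(`p ≤ 2t+1`: `(1 - g)⁻¹ ≤ 2 ≤ 1 + (2t+1)²/p²`; `p ≥ 2t+2`:
`(p-t)/(p-t-1) ≤ (p² + (2t+1)²)/(p(p-1))`). -/
theorem inv_one_sub_le_mertensFactor {g : ℝ} {p : ℕ} (hp : p.Prime) (t : ℕ) (hg2 : g ≤ 1 / 2)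
    (hgt : t < p → g ≤ 1 / ((p : ℝ) - t)) :
    (1 - g)⁻¹ ≤ (1 - (p : ℝ)⁻¹)⁻¹ * Real.exp ((2 * (t : ℝ) + 1) ^ 2 / (p : ℝ) ^ 2) := by
  have hp2 : (2 : ℝ) ≤ p := by exact_mod_cast hp.two_le
  have hp0 : (0 : ℝ) < p := by linarith
  have ht0 : (0 : ℝ) ≤ t := Nat.cast_nonneg t
  have hexp : 1 + (2 * (t : ℝ) + 1) ^ 2 / (p : ℝ) ^ 2 ≤
      Real.exp ((2 * (t : ℝ) + 1) ^ 2 / (p : ℝ) ^ 2) := by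
    linarith [Real.add_one_le_exp ((2 * (t : ℝ) + 1) ^ 2 / (p : ℝ) ^ 2)]
  -- the Mertens factor `(1 - 1/p)⁻¹ = p/(p-1) ≥ 1`
  have hM : (1 - (p : ℝ)⁻¹)⁻¹ = p / ((p : ℝ) - 1) := by
    rw [inv_eq_one_div (p : ℝ), one_sub_div hp0.ne', inv_div]
  have hM1 : 1 ≤ (1 - (p : ℝ)⁻¹)⁻¹ := by
    rw [hM, le_div_iff₀ (by linarith)]
    linarith
  have hM0 : 0 ≤ (1 - (p : ℝ)⁻¹)⁻¹ := zero_le_one.trans hM1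
  refine le_trans ?_ (mul_le_mul_of_nonneg_left hexp hM0)
  rcases lt_or_ge p (2 * t + 2) with hsmall | hlarge
  · -- small prime `p ≤ 2t + 1`
    have h2 : (1 - g)⁻¹ ≤ 2 :=
      calc (1 - g)⁻¹ ≤ (1 / 2 : ℝ)⁻¹ := inv_anti₀ (by norm_num) (by linarith)
        _ = 2 := by norm_num
    have hp21 : (p : ℝ) ≤ 2 * t + 1 := by exact_mod_cast (by omega : p ≤ 2 * t + 1)
    have hKp : 1 ≤ (2 * (t : ℝ) + 1) ^ 2 / (p : ℝ) ^ 2 := by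
      rw [le_div_iff₀ (by positivity), one_mul]
      exact pow_le_pow_left₀ hp0.le hp21 2
    calc (1 - g)⁻¹ ≤ 2 := h2
      _ ≤ 1 * (1 + (2 * (t : ℝ) + 1) ^ 2 / (p : ℝ) ^ 2) := by linarith
      _ ≤ (1 - (p : ℝ)⁻¹)⁻¹ * (1 + (2 * (t : ℝ) + 1) ^ 2 / (p : ℝ) ^ 2) :=
          mul_le_mul_of_nonneg_right hM1 (by positivity)
  · -- large prime `p ≥ 2t + 2`
    have hpt : 2 * (t : ℝ) + 2 ≤ p := by exact_mod_cast hlarge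
    have hg := hgt (by omega)
    have hd : (1 : ℝ) < (p : ℝ) - t := by linarith
    have h1 : (1 - g)⁻¹ ≤ (1 - 1 / ((p : ℝ) - t))⁻¹ := by
      refine inv_anti₀ ?_ (by linarith)
      rw [sub_pos, div_lt_one (by linarith)]
      exact hd
    have h2 : (1 - 1 / ((p : ℝ) - t))⁻¹ = ((p : ℝ) - t) / ((p : ℝ) - t - 1) := by
      rw [one_sub_div (by linarith : (p : ℝ) - t ≠ 0), inv_div]
    have hp1 : (p : ℝ) - 1 ≠ 0 := ne_of_gt (by linarith)
    have h3 : (1 - (p : ℝ)⁻¹)⁻¹ * (1 + (2 * (t : ℝ) + 1) ^ 2 / (p : ℝ) ^ 2) =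
        ((p : ℝ) ^ 2 + (2 * (t : ℝ) + 1) ^ 2) / ((p : ℝ) * ((p : ℝ) - 1)) := by
      rw [hM, one_add_div (by positivity : (p : ℝ) ^ 2 ≠ 0), div_mul_div_comm,
        div_eq_div_iff (mul_ne_zero hp1 (by positivity)) (mul_ne_zero hp0.ne' hp1)]
      ring
    calc (1 - g)⁻¹ ≤ (1 - 1 / ((p : ℝ) - t))⁻¹ := h1
      _ = ((p : ℝ) - t) / ((p : ℝ) - t - 1) := h2
      _ ≤ ((p : ℝ) ^ 2 + (2 * (t : ℝ) + 1) ^ 2) / ((p : ℝ) * ((p : ℝ) - 1)) := by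
          rw [div_le_div_iff₀ (by linarith) (by nlinarith)]
          nlinarith [mul_nonneg (by linarith : (0 : ℝ) ≤ (p : ℝ) - t - 1)
              (by positivity : (0 : ℝ) ≤ 4 * (t : ℝ) ^ 2 + 2 * t + 1),
            mul_nonneg ht0 (by linarith : (0 : ℝ) ≤ (p : ℝ) - 2 * t - 2)]
      _ = (1 - (p : ℝ)⁻¹)⁻¹ * (1 + (2 * (t : ℝ) + 1) ^ 2 / (p : ℝ) ^ 2) := h3.symm

/-- **Mertens' product theorem with rate, for a window**: for `2 ≤ w ≤ z`,
`Π(z)/Π(w) ≤ (log z / log w) e^{50/log w}` (`PairProducts.abs_log_mertensProd_sub_le` twice). -/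
theorem mertensProd_div_le {w z : ℝ} (hw : 2 ≤ w) (hwz : w ≤ z) :
    PairProducts.mertensProd z / PairProducts.mertensProd w ≤
      Real.log z / Real.log w * Real.exp (50 / Real.log w) := by
  -- adapted from `hasIwaniecDimension_shiftedPrimesDensity_two` (ChenTwinSieveLowerHolds.lean)
  have hlogw : 0 < Real.log w := Real.log_pos (by linarith)
  have hlogz : 0 < Real.log z := Real.log_pos (by linarith)
  set R := PairProducts.mertensProd z / PairProducts.mertensProd w with hR
  have hRpos : 0 < R := div_pos (PairProducts.mertensProd_pos z) (PairProducts.mertensProd_pos w)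
  obtain ⟨-, hz2⟩ := abs_le.mp (PairProducts.abs_log_mertensProd_sub_le (le_trans hw hwz))
  obtain ⟨hw1, -⟩ := abs_le.mp (PairProducts.abs_log_mertensProd_sub_le hw)
  have hlogR : Real.log R ≤ Real.log (Real.log z) - Real.log (Real.log w) + 50 / Real.log w := by
    rw [hR, Real.log_div (PairProducts.mertensProd_pos z).ne' (PairProducts.mertensProd_pos w).ne']
    have : 25 / Real.log z ≤ 25 / Real.log w :=
      div_le_div_of_nonneg_left (by norm_num) hlogw (Real.log_le_log (by linarith) hwz)
    have e50 : (50 : ℝ) / Real.log w = 2 * (25 / Real.log w) := by ring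
    linarith
  have e1 : R = Real.exp (Real.log R) := (Real.exp_log hRpos).symm
  have e2 : Real.log z / Real.log w * Real.exp (50 / Real.log w) =
      Real.exp (Real.log (Real.log z) - Real.log (Real.log w) + 50 / Real.log w) := by
    rw [Real.exp_add, Real.exp_sub, Real.exp_log hlogz, Real.exp_log hlogw]
  rw [e1, e2, Real.exp_le_exp]
  exact hlogR

/-- `e^{C/log w} ≤ 1 + (C e^{C/log 2})/log w` for `C ≥ 0`, `w ≥ 2` (`e^x ≤ 1 + x e^x`). -/
theorem exp_div_log_le {C w : ℝ} (hC : 0 ≤ C) (hw : 2 ≤ w) :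
    Real.exp (C / Real.log w) ≤ 1 + C * Real.exp (C / Real.log 2) / Real.log w := by
  have hlog2 : 0 < Real.log 2 := Real.log_pos one_lt_two
  have hlogw : 0 < Real.log w := Real.log_pos (by linarith)
  have hlog2w : Real.log 2 ≤ Real.log w := Real.log_le_log two_pos hw
  have hT0 : 0 ≤ C / Real.log w := div_nonneg hC hlogw.le
  have hTle : C / Real.log w ≤ C / Real.log 2 := div_le_div_of_nonneg_left hC hlog2 hlog2w
  calc Real.exp (C / Real.log w) ≤ 1 + C / Real.log w * Real.exp (C / Real.log w) :=
        PairProducts.exp_le_one_add_mul_exp _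
    _ ≤ 1 + C / Real.log w * Real.exp (C / Real.log 2) := by gcongr
    _ = 1 + C * Real.exp (C / Real.log 2) / Real.log w := by ring

/-- **The window product of the section density**, under `g(p) < 1` for all `p`: for `2 ≤ w ≤ z`,
`∏_{w ≤ p < z} (1 - g(p))⁻¹ ≤ (log z/log w) e^{(50 + 2(2t+1)²)/log w}` (termwise majorant, Mertens with
rate, and `∑_{w ≤ p} 1/p² ≤ 2/w ≤ 2/log w`, the tree's `sum_window_inv_sq_le`). -/
theorem prod_window_le (Ψ : Fin (t + 1) → AffLinForm 1) (i : Fin (t + 1))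
    (h : ∀ p : ℕ, p.Prime → sectionDensity Ψ i p < 1) {w z : ℝ} (hw : 2 ≤ w) (hwz : w ≤ z) :
    ∏ p ∈ (Nat.primesBelow ⌈z⌉₊).filter (fun p : ℕ => w ≤ (p : ℝ)), (1 - sectionDensityFn Ψ i p)⁻¹ ≤
      Real.log z / Real.log w * Real.exp ((50 + 2 * (2 * (t : ℝ) + 1) ^ 2) / Real.log w) := by
  set S := (Nat.primesBelow ⌈z⌉₊).filter (fun p : ℕ => w ≤ (p : ℝ)) with hS
  have hlogw : 0 < Real.log w := Real.log_pos (by linarith)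
  have hlogz : 0 < Real.log z := Real.log_pos (by linarith)
  have hmem : ∀ p ∈ S, p.Prime := fun p hp =>
    Nat.prime_of_mem_primesBelow (Finset.mem_filter.mp hp).1
  have hnonneg : ∀ p ∈ S, 0 ≤ (1 - sectionDensityFn Ψ i p)⁻¹ := fun p hp => by
    haveI := Fact.mk (hmem p hp)
    rw [sectionDensityFn_apply Ψ i (hmem p hp).ne_zero]
    exact inv_nonneg.mpr (sub_nonneg.mpr (h p (hmem p hp)).le)
  have hpt : ∀ p ∈ S, (1 - sectionDensityFn Ψ i p)⁻¹ ≤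
      (1 - (p : ℝ)⁻¹)⁻¹ * Real.exp ((2 * (t : ℝ) + 1) ^ 2 / (p : ℝ) ^ 2) := fun p hp => by
    haveI := Fact.mk (hmem p hp)
    rw [sectionDensityFn_apply Ψ i (hmem p hp).ne_zero]
    exact inv_one_sub_le_mertensFactor (hmem p hp) t
      (sectionDensity_prime_le_half Ψ i p (h p (hmem p hp)))
      fun htp => sectionDensity_prime_le_inv Ψ i p (h p (hmem p hp)) htp
  -- the product is at most `(Π(z)/Π(w)) · exp(∑ (2t+1)²/p²)`
  have hprod : ∏ p ∈ S, (1 - sectionDensityFn Ψ i p)⁻¹ ≤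
      PairProducts.mertensProd z / PairProducts.mertensProd w *
        Real.exp (∑ p ∈ S, (2 * (t : ℝ) + 1) ^ 2 / (p : ℝ) ^ 2) := by
    calc ∏ p ∈ S, (1 - sectionDensityFn Ψ i p)⁻¹
        ≤ ∏ p ∈ S, ((1 - (p : ℝ)⁻¹)⁻¹ * Real.exp ((2 * (t : ℝ) + 1) ^ 2 / (p : ℝ) ^ 2)) :=
          Finset.prod_le_prod hnonneg hpt
      _ = PairProducts.mertensProd z / PairProducts.mertensProd w *
            Real.exp (∑ p ∈ S, (2 * (t : ℝ) + 1) ^ 2 / (p : ℝ) ^ 2) := by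
          rw [Finset.prod_mul_distrib, ← Real.exp_sum, hS,
            PairProducts.prod_filter_eq_mertensProd_div hwz]
  -- the `1/p²` tail
  have hE : ∑ p ∈ S, (2 * (t : ℝ) + 1) ^ 2 / (p : ℝ) ^ 2 ≤
      2 * (2 * (t : ℝ) + 1) ^ 2 / Real.log w := by
    have h1 := Literature.NumberTheory.Sieve.sum_window_inv_sq_le (z := z) hw
    rw [← hS] at h1
    have hlw : Real.log w ≤ w := by
      linarith [Real.log_le_sub_one_of_pos (by linarith : (0 : ℝ) < w)]
    have hE' : ∑ p ∈ S, (2 * (t : ℝ) + 1) ^ 2 / (p : ℝ) ^ 2 =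
        (2 * (t : ℝ) + 1) ^ 2 * ∑ p ∈ S, 1 / (p : ℝ) ^ 2 := by
      rw [Finset.mul_sum]
      exact Finset.sum_congr rfl fun p _ => by ring
    rw [hE']
    calc (2 * (t : ℝ) + 1) ^ 2 * ∑ p ∈ S, 1 / (p : ℝ) ^ 2 ≤ (2 * (t : ℝ) + 1) ^ 2 * (2 / w) :=
          mul_le_mul_of_nonneg_left h1 (by positivity)
      _ = 2 * (2 * (t : ℝ) + 1) ^ 2 / w := by ring
      _ ≤ 2 * (2 * (t : ℝ) + 1) ^ 2 / Real.log w :=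
          div_le_div_of_nonneg_left (by positivity) hlogw hlw
  calc ∏ p ∈ S, (1 - sectionDensityFn Ψ i p)⁻¹
      ≤ PairProducts.mertensProd z / PairProducts.mertensProd w *
          Real.exp (∑ p ∈ S, (2 * (t : ℝ) + 1) ^ 2 / (p : ℝ) ^ 2) := hprod
    _ ≤ (Real.log z / Real.log w * Real.exp (50 / Real.log w)) *
          Real.exp (2 * (2 * (t : ℝ) + 1) ^ 2 / Real.log w) :=
        mul_le_mul (mertensProd_div_le hw hwz) (Real.exp_le_exp.mpr hE) (Real.exp_pos _).le
          (by positivity)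
    _ = Real.log z / Real.log w * Real.exp ((50 + 2 * (2 * (t : ℝ) + 1) ^ 2) / Real.log w) := by
        rw [mul_assoc, ← Real.exp_add]
        congr 2
        ring

end DimensionAux

open DimensionAux in
/-- **`stub_sectionDimension`** (registered stub of the line `section-annihilator`, skeleton v9):
`SectionDimension` — for every `t`, with `C_t = 50 + 2(2t+1)²` and `L' = C_t e^{C_t/log 2}`, every
section density `g_{Ψ,i}` of a `(t+1)`-form system with `g(p) < 1` at all primes satisfies Iwaniec's
`Ω(1, L')`: `0 ≤ g(p) < 1` and `∏_{w ≤ p < z} (1 - g(p))⁻¹ ≤ (log z/log w)(1 + L'/log w)` for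
`2 ≤ w ≤ z` (each form has `0`, `1` or `p` zeros mod `p`, so `g(p) ≤ 1/2` and `g(p) ≤ 1/(p-t)` for
`p > t`; Mertens' product theorem with rate). -/
theorem stub_sectionDimension : SectionDimension := by
  intro t
  refine ⟨(50 + 2 * (2 * (t : ℝ) + 1) ^ 2) *
      Real.exp ((50 + 2 * (2 * (t : ℝ) + 1) ^ 2) / Real.log 2),
    fun Ψ i h => ⟨fun p hp => ?_, fun w z hw hwz => ?_⟩⟩
  · haveI := Fact.mk hp
    rw [sectionDensityFn_apply Ψ i hp.ne_zero]
    exact ⟨sectionDensity_prime_nonneg Ψ i p, h p hp⟩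
  · have hlogw : 0 < Real.log w := Real.log_pos (by linarith)
    have hlogz : 0 < Real.log z := Real.log_pos (by linarith)
    rw [Real.rpow_one]
    calc ∏ p ∈ (Nat.primesBelow ⌈z⌉₊).filter (fun p : ℕ => w ≤ (p : ℝ)), (1 - sectionDensityFn Ψ i p)⁻¹
        ≤ Real.log z / Real.log w * Real.exp ((50 + 2 * (2 * (t : ℝ) + 1) ^ 2) / Real.log w) :=
          prod_window_le Ψ i h hw hwz
      _ ≤ Real.log z / Real.log w * (1 + (50 + 2 * (2 * (t : ℝ) + 1) ^ 2) *
            Real.exp ((50 + 2 * (2 * (t : ℝ) + 1) ^ 2) / Real.log 2) / Real.log w) :=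
          mul_le_mul_of_nonneg_left (exp_div_log_le (by positivity) hw) (by positivity)

end Summit.Parity.GeneralizedHardyLittlewood.Cruxes.CellParityLaw.SectionAnnihilator

end
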